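import Mathlib.NumberTheory.Padics.HeightOneSpectrum
import Literature.NumberTheory.EllipticCurves.NeronModel
import Literature.NumberTheory.EllipticCurves.Tamagawa
import Literature.NumberTheory.DiophantineGeometry.TateAlgorithm
import Literature.NumberTheory.DiophantineGeometry.KodairaSymbol
import Literature.NumberTheory.DiophantineGeometry.LocalReduction
import Literature.NumberTheory.DiophantineGeometry.MinimalDiscriminant
import Literature.NumberTheory.DiophantineGeometry.Conductor
import HarnessLib

-- provenance: harness21/H21/H21/Statements/BSD/NeronTamagawa.lean @ 0c3bcbe (interim HEAD d8f2665); M5 mechanical rewrite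
/-!
# BSD: local Tamagawa numbers and the Néron component group

Family `bsd`, trunk T-ELLARITH (G16 `EllArithM`), outline item `BSDNeronStatements` (tier L).

## Statements

* **bsd.S14** (Tate, *Algorithm for determining the type of a singular fiber in an elliptic
  pencil*, Antwerp IV, LNM 476 (1975), §1; Silverman, *AEC*, Thm. VII.6.1; Silverman, *ATAEC*,
  IV.9, Cor. 9.2): the local Tamagawa number of an elliptic curve `E / ℚ` at a prime `p` is
  `c_p = [E(ℚ_p) : E₀(ℚ_p)] = #Φ_p(𝔽_p)`, the number of `𝔽_p`-rational components of the special
  fibre of the Néron model, and `c_p = 1` at primes of good reduction.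

  - `Literature.NumberTheory.EllipticCurves.localTamagawaNumber_eq_card_componentGroup` : `c_p = #Φ_p(𝔽_p)` (over `ℚ`, at a
    rational prime `p`, the place being `Literature.BSD.placeOfPrime p`);
  - `Literature.NumberTheory.EllipticCurves.localTamagawaNumber_eq_one_of_good'` : `c_v = 1` for good reduction (restating G06
    `WeierstrassCurve.localTamagawaNumber_eq_one_of_hasGoodReductionAt` over any Dedekind domain);
  - `Literature.NumberTheory.EllipticCurves.localTamagawaNumber_dvd_componentGroupOrder` : `c_v ∣ #Φ_v(k̄_v)`, the order read
    off from the Kodaira symbol;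
  - `Literature.NumberTheory.EllipticCurves.localTamagawaNumber_le_four_of_additive` : `c_v ≤ 4` for additive reduction
    (Kodaira–Néron table);
  - `Literature.NumberTheory.EllipticCurves.localTamagawaNumber_eq_ordΔ_of_split_multiplicative` : `c_v = ord_v(Δ_min)` for split
    multiplicative reduction.

## Design

* The local Tamagawa number at a finite place `v` is written exactly as the factor of G06's
  `WeierstrassCurve.tamagawaProduct`, namely
  `(W.baseChange (v.adicCompletion K)).localTamagawaNumber (v.adicCompletionIntegers K)`
  (local ring `O_v = v.adicCompletionIntegers K`, not `ℤ_[p]`), so that the G06/G16 lemmas rewrite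
  syntactically.
* The Néron-model input is the hypothesis structure `Literature.NeronComponentData W v` of
  `Literature.Prelude.EllArithM.NeronModel` (component group `Φ` with its Frobenius); its existence for
  elliptic curves at places with finite residue field is `Literature.NumberTheory.EllipticCurves.nonempty_neronComponentData`. The
  general lemmas are stated over the fraction field `K` of a Dedekind domain `A` at a place `v`
  with finite residue field `[Finite (IsLocalRing.ResidueField (v.adicCompletionIntegers K))]`;
  over `ℚ` this instance is `Literature.NumberTheory.DiophantineGeometry.Rat.finite_residueField_adicCompletionIntegers`
  (`Literature.Prelude.DiophValNum.Conductor`), whence the hypothesis-free `ℚ` versions.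
* The rational prime `p` is turned into a finite place of `𝓞 ℚ` by Mathlib's
  `Rat.HeightOneSpectrum.primesEquiv` (`Mathlib.NumberTheory.Padics.HeightOneSpectrum`, which
  also provides `ℤ_[p] ≃ O_v`, `PadicInt.adicCompletionIntegersEquiv`); we abbreviate
  `Literature.BSD.placeOfPrime p := primesEquiv.symm ⟨p, _⟩`.
* Mathlib search: Mathlib has `WeierstrassCurve.HasGoodReduction` etc. and the `p`-adic /
  height-one-spectrum dictionary above, but no Tamagawa number, Néron model or component group
  (`rg -i 'tamagawa|n[eé]ron|componentGroup'` over Mathlib: no hits), so everything here rests on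
  the H21 preludes G06 (`Tamagawa`), G16 (`NeronModel`), G22 (`TateAlgorithm`, `KodairaSymbol`,
  `LocalReduction`, `MinimalDiscriminant`).
* All statements in this file are known theorems, proved here from the prelude API; the unproved
  upstream inputs (`nonempty_neronComponentData`, Tate's algorithm lemmas, …) are named facts
  (D-0014) and enter the statements as explicit hypotheses.

`noncomputable section`, `open scoped Classical`, `namespace Literature.BSD`.
-/

noncomputable section

open scoped Classical

open IsDedekindDomain NumberField

namespace Literature.NumberTheory.EllipticCurves

section General

variable {A : Type*} [CommRing A] [IsDedekindDomain A] {K : Type*} [Field K] [Algebra A K]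
  [IsFractionRing A K] (v : HeightOneSpectrum A) (W : WeierstrassCurve K)

/-- **bsd.S14** (good-reduction clause; Tate, Antwerp IV, LNM 476 (1975), §1; Silverman, *AEC*,
VII.2, remark after Prop. 2.1). If `W` has good reduction at the finite place `v` then every point
of `E(K_v)` has nonsingular reduction, `E₀(K_v) = E(K_v)`, and the local Tamagawa number is
`c_v = 1`. Restatement of G06's `WeierstrassCurve.localTamagawaNumber_eq_one_of_hasGoodReductionAt`
over an arbitrary Dedekind domain (G06 states it for `𝓞 K` of a number field), given the named
fact `WeierstrassCurve.localTamagawaNumber_eq_one_of_hasGoodReduction` over `O_v` as the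
hypothesis `hgood` (D-0014). [folklore] -/
theorem localTamagawaNumber_eq_one_of_good'
    (hgood : WeierstrassCurve.localTamagawaNumber_eq_one_of_hasGoodReduction
      (v.adicCompletionIntegers K) (W.baseChange (v.adicCompletion K)))
    (h : W.HasGoodReductionAt v) :
    (W.baseChange (v.adicCompletion K)).localTamagawaNumber (v.adicCompletionIntegers K) = 1 :=
  haveI : ((W.baseChange (v.adicCompletion K)).minimal
      (v.adicCompletionIntegers K)).HasGoodReduction (v.adicCompletionIntegers K) := h
  hgood

variable [W.IsElliptic] [Finite (IsLocalRing.ResidueField (v.adicCompletionIntegers K))]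

/-- `c_v ∣ #Φ_v(k̄_v)`: the local Tamagawa number `c_v = #Φ_v(k_v)` divides the order of the
geometric component group of the Néron model, i.e. the value
`(W.kodairaSymbolAt v).componentGroupOrder` read off from the Kodaira symbol (Lagrange for the
subgroup of Frobenius-fixed components; Silverman, *ATAEC*, Cor. IV.9.2(c),(d) and Table 4.1;
Tate, Antwerp IV (1975), §1). The existence of Néron component data (named fact
`Literature.NumberTheory.EllipticCurves.nonempty_neronComponentData`) is the hypothesis `hN` (D-0014). [cite: IV1975] -/
theorem localTamagawaNumber_dvd_componentGroupOrder (hN : nonempty_neronComponentData W v) :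
    (W.baseChange (v.adicCompletion K)).localTamagawaNumber (v.adicCompletionIntegers K) ∣
      (W.kodairaSymbolAt v).componentGroupOrder := by
  obtain ⟨D⟩ := hN
  rw [localTamagawaNumber_eq_rationalComponents D,
    D.rationalComponents_eq_card_rationalSubgroup, ← D.card_eq, ← Nat.card_eq_fintype_card]
  exact D.rationalSubgroup.card_addSubgroup_dvd_card

/-- The Kodaira–Néron table for additive reduction (Silverman, *AEC*, Thm. VII.6.1; *ATAEC*,
Cor. IV.9.2 and Table 4.1; Tate, Antwerp IV (1975), §1): if `W` has additive reduction at `v`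
then `c_v ≤ 4` (the additive types `II, III, IV, I₀*, Iₙ*, IV*, III*, II*` have component groups of
order `1, 2, 3, 4, 4 or 2·2, 3, 2, 1`). The finite residue field makes it perfect, as required by
Tate's algorithm (`WeierstrassCurve.isAdditive_kodairaSymbolAt_iff`, hypothesis `hadd`; Néron
component data, hypothesis `hN` — both named facts, D-0014). [cite: IV1975] -/
theorem localTamagawaNumber_le_four_of_additive (hN : nonempty_neronComponentData W v)
    (hadd : WeierstrassCurve.isAdditive_kodairaSymbolAt_iff v W) (h : W.HasAdditiveReductionAt v) :
    (W.baseChange (v.adicCompletion K)).localTamagawaNumber (v.adicCompletionIntegers K) ≤ 4 := by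
  obtain ⟨D⟩ := hN
  rw [localTamagawaNumber_eq_rationalComponents D]
  exact rationalComponents_le_four_of_isAdditive D (hadd.mpr h)

/-- Split multiplicative reduction (Tate, Antwerp IV (1975), §1; Silverman, *AEC*, Thm. VII.6.1;
*ATAEC*, Cor. IV.9.2(b),(d)): if `W` has split multiplicative reduction at `v`, of type `Iₙ`, then
Frobenius acts trivially on the cyclic component group of order `n`, so
`c_v = n = ord_v(Δ_min)` (`WeierstrassCurve.ordMinimalDiscriminant`). The named facts
`Literature.NumberTheory.EllipticCurves.nonempty_neronComponentData`, `WeierstrassCurve.ordMinimalDiscriminant_eq_zero_iff`,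
`WeierstrassCurve.kodairaSymbolAt_eq_I_iff` and
`Literature.NumberTheory.EllipticCurves.rationalComponents_eq_card_of_hasSplitMultiplicativeReductionAt` enter as hypotheses
(D-0014). [cite: IV1975] -/
theorem localTamagawaNumber_eq_ordΔ_of_split_multiplicative (hN : nonempty_neronComponentData W v)
    (hΔ : WeierstrassCurve.ordMinimalDiscriminant_eq_zero_iff v W)
    (hI' : WeierstrassCurve.kodairaSymbolAt_eq_I_iff v W)
    (hsplit : rationalComponents_eq_card_of_hasSplitMultiplicativeReductionAt (W := W) (v := v))
    (h : W.HasSplitMultiplicativeReductionAt v) :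
    (W.baseChange (v.adicCompletion K)).localTamagawaNumber (v.adicCompletionIntegers K) =
      W.ordMinimalDiscriminant v := by
  obtain ⟨D⟩ := hN
  have hm := h.hasMultiplicativeReductionAt
  have hn : W.ordMinimalDiscriminant v ≠ 0 := fun h0 =>
    (hΔ.mp h0).not_hasMultiplicativeReductionAt hm
  have hI : W.kodairaSymbolAt v = .I (W.ordMinimalDiscriminant v) :=
    (hI' hn).mpr ⟨hm, rfl⟩
  rw [localTamagawaNumber_eq_rationalComponents D, hsplit D h, D.card_eq, hI,
    DiophantineGeometry.KodairaSymbol.componentGroupOrder_I]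
  exact max_eq_left (Nat.one_le_iff_ne_zero.mpr hn)

end General

section Rat

/-- The finite place of `ℚ` (height-one prime of `𝓞 ℚ`) attached to the rational prime `p`, via
Mathlib's `Rat.HeightOneSpectrum.primesEquiv : HeightOneSpectrum (𝓞 ℚ) ≃ Nat.Primes`
(the prime `(p)`; its completion is `ℚ_p`, `Padic.adicCompletionEquiv`). [folklore] -/
abbrev placeOfPrime (p : ℕ) [Fact p.Prime] : HeightOneSpectrum (𝓞 ℚ) :=
  Rat.HeightOneSpectrum.primesEquiv.symm ⟨p, Fact.out⟩

/-- `primesEquiv (placeOfPrime p) = p` (Mathlib `Equiv.apply_symm_apply`); not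
`@[simp]` since `simp` already proves it by unfolding the `abbrev`. [folklore] -/
theorem primesEquiv_placeOfPrime (p : ℕ) [Fact p.Prime] :
    (Rat.HeightOneSpectrum.primesEquiv (placeOfPrime p) : ℕ) = p := by
  simp [placeOfPrime]

variable (W : WeierstrassCurve ℚ) (p : ℕ) [Fact p.Prime]

/-- **bsd.S14** (Tate, *Algorithm for determining the type of a singular fiber in an elliptic
pencil*, Antwerp IV, LNM 476 (1975), §1; Silverman, *AEC*, Thm. VII.6.1; Silverman, *ATAEC*,
IV.9, Cor. 9.2(d)). For an elliptic curve `E / ℚ` and a prime `p`, the local Tamagawa number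
`c_p = [E(ℚ_p) : E₀(ℚ_p)]` (G06 `WeierstrassCurve.localTamagawaNumber`, computed over
`O_v ≃ ℤ_p` at the place `v = placeOfPrime p`) equals `#Φ_p(𝔽_p)`, the number of `𝔽_p`-rational
connected components of the special fibre of the Néron model of `E` at `p`
(`Literature.NumberTheory.EllipticCurves.NeronComponentData.rationalComponents`), as computed by Tate's algorithm. [folklore] -/
theorem localTamagawaNumber_eq_card_componentGroup
    (D : NeronComponentData W (placeOfPrime p)) :
    (W.baseChange ((placeOfPrime p).adicCompletion ℚ)).localTamagawaNumber
        ((placeOfPrime p).adicCompletionIntegers ℚ) = D.rationalComponents :=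
  localTamagawaNumber_eq_rationalComponents D

variable [W.IsElliptic]

/-- Over `ℚ` the component-group data at every prime exists unconditionally (the residue field
`𝔽_p` of `O_v ≃ ℤ_p` is finite: `Literature.NumberTheory.DiophantineGeometry.Rat.finite_residueField_adicCompletionIntegers`), so
**bsd.S14** can be phrased without the datum `D`: there is a Néron component group at `p` whose
number of `𝔽_p`-rational elements is `c_p` (Kodaira–Néron–Tate; Silverman, *ATAEC*, IV.9.2).
The named fact `Literature.NumberTheory.EllipticCurves.nonempty_neronComponentData` is the hypothesis `hN` (D-0014). [folklore] -/
theorem exists_neronComponentData_rationalComponents_eq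
    (hN : nonempty_neronComponentData W (placeOfPrime p)) :
    ∃ D : NeronComponentData W (placeOfPrime p),
      (W.baseChange ((placeOfPrime p).adicCompletion ℚ)).localTamagawaNumber
        ((placeOfPrime p).adicCompletionIntegers ℚ) = D.rationalComponents := by
  obtain ⟨D⟩ := hN
  exact ⟨D, localTamagawaNumber_eq_card_componentGroup W p D⟩

/-- `c_p ≤ 4` at primes of additive reduction of an elliptic curve over `ℚ` (Silverman, *AEC*,
Thm. VII.6.1; specialisation of `localTamagawaNumber_le_four_of_additive`, with the same two
named facts as hypotheses, D-0014). [folklore] -/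
theorem localTamagawaNumber_le_four_of_additive_rat
    (hN : nonempty_neronComponentData W (placeOfPrime p))
    (hadd : WeierstrassCurve.isAdditive_kodairaSymbolAt_iff (placeOfPrime p) W)
    (h : W.HasAdditiveReductionAt (placeOfPrime p)) :
    (W.baseChange ((placeOfPrime p).adicCompletion ℚ)).localTamagawaNumber
        ((placeOfPrime p).adicCompletionIntegers ℚ) ≤ 4 :=
  localTamagawaNumber_le_four_of_additive _ W hN hadd h

end Rat

end Literature.NumberTheory.EllipticCurves

end
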